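import Literature.NumberTheory.LFunctions.WeilFirstPrimeCertificateDataC
import HarnessLib

/-!
# First-prime Weil positivity, stage C: kernel check of the even scaled moments ν_156, ν_158, ν_160, ν_162, ν_164, ν_166

Part of `weilCert3C.check` (`WeilFirstPrimeCertificateDataC.lean`), evaluated by `decide +kernel` and kept in its own
file for kernel time and memory (each declaration is checked separately). Assembled in
`WeilFirstPrimeCertificateCCheck.lean`. Pure proof file; nothing is asserted.
-/

noncomputable section

namespace Literature.NumberTheory.LFunctions

set_option maxHeartbeats 0 in
/-- **Kernel check of the scaled moment `ν_{156}`** of the stage-C first-prime certificate. [folklore] -/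
theorem checkNuAt156_weilCert3C : weilCert3C.checkNuAt 156 = true := by
  decide +kernel

set_option maxHeartbeats 0 in
/-- **Kernel check of the scaled moment `ν_{158}`** of the stage-C first-prime certificate. [folklore] -/
theorem checkNuAt158_weilCert3C : weilCert3C.checkNuAt 158 = true := by
  decide +kernel

set_option maxHeartbeats 0 in
/-- **Kernel check of the scaled moment `ν_{160}`** of the stage-C first-prime certificate. [folklore] -/
theorem checkNuAt160_weilCert3C : weilCert3C.checkNuAt 160 = true := by
  decide +kernel

set_option maxHeartbeats 0 in
/-- **Kernel check of the scaled moment `ν_{162}`** of the stage-C first-prime certificate. [folklore] -/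
theorem checkNuAt162_weilCert3C : weilCert3C.checkNuAt 162 = true := by
  decide +kernel

set_option maxHeartbeats 0 in
/-- **Kernel check of the scaled moment `ν_{164}`** of the stage-C first-prime certificate. [folklore] -/
theorem checkNuAt164_weilCert3C : weilCert3C.checkNuAt 164 = true := by
  decide +kernel

set_option maxHeartbeats 0 in
/-- **Kernel check of the scaled moment `ν_{166}`** of the stage-C first-prime certificate. [folklore] -/
theorem checkNuAt166_weilCert3C : weilCert3C.checkNuAt 166 = true := by
  decide +kernel

end Literature.NumberTheory.LFunctions
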